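import Summits.QuantumFields.YangMills.Theorems.F4SubCurvatureDoorSubCurvatureKernelMollifier
import Summits.QuantumFields.YangMills.Theorems.F4SubCurvatureDoorSubCurvatureKernelPointwiseRP
import Literature.Analysis.FunctionSpaces.LaplaceFourierMeasure
import Literature.MathematicalPhysics.QuantumLattice.MinkowskiGeometry
import Mathlib
import HarnessLib

/-!
# Route `F4SubCurvatureDoor`, crux `SubCurvatureKernel` ⟨stmt-QuantumFields-23036⟩ — soft half, input (C) «continuity off 0»,
# part 2: the mollified kernel is POINTWISE OS-positive-definite (from `RPPos`), hence has a LAPLACE–FOURIER MEASURE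

Helper file (`--supports stmt-QuantumFields-23036 --as helper`; free-hands seat `ym-line-frs-p2` g18).  Definition-free, 0 sorry,
standard axioms.  No item is closed; no summit, no crux and no mass gap is proved by this file.

WHAT.  Let `S₁` be reflection positive on positive-time off-diagonal tuples (`RPPos`) with two-point functional represented on
compactly supported off-diagonal test functions by a real kernel `K` (`S₁ 2 F = ∫ (K(y₀ − y₁) : ℂ) F`, clause 6), and let `κ` be a
mollification of `K` by a smooth bump `b` of radius `ε < s₀` in the sense of ✓`exists_mollifiedKernel`
(`κ w = ∫∫ K(w + θu − v) b(v) b(u)` whenever `2s₀ ≤ |w₀|`).  Then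
* ★ `mollified_pd` — `Σᵢⱼ cᵢcⱼ κ(θxᵢ − xⱼ) ≥ 0` for all points with `(xᵢ)₀ ≥ s₀`, EXACTLY: with the degree-one tuple
  `fᵢ = cᵢ b(· − xᵢ)` (positive time since `ε < s₀`) and `Hᵢⱼ = osAdjoint fᵢ ⊗ fⱼ`, `RPPos` gives `0 ≤ Re Σ S₁ 2 Hᵢⱼ`, and
  `S₁ 2 Hᵢⱼ = cᵢcⱼ κ(θxᵢ − xⱼ)` by clause 6 and the OS change of variables ✓`integral_osShift` (pattern of ✓`pointwise_rp_of_rpPos`,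
  with the η-argument replaced by an identity);
* ★ `exists_laplaceFourier_mollified` — if moreover `κ` is continuous, bounded and invariant under the spatial inversion `−θ`, the
  slices `k t z⃗ := κ(−(2s₀ + t), z⃗)` satisfy the hypotheses of ✓`Literature…exists_laplaceFourierMeasure`: there is a positive measure
  `μ` on `ℝ × ℝ³` carried by `E ≥ 0` with `∫ e^{−tE} dμ < ∞` and `κ(−(2s₀ + t), z⃗) = ∫ e^{−tE} cos⟪q, z⃗⟫ dμ(E, q)` for `t > 0`.
Coordinates: `(t, z⃗) ↦ ofTimeSpace t z⃗` (Literature `MinkowskiGeometry`, `d = 3`).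

HONEST LABEL: one step of input (C) of the SOFT half of ⟨23036⟩ (the limit `ε → 0` and the gluing are the next files); the
SUB-CURVATURE clause (asymptotic freedom) is the crux, untouched; ⟨23036⟩ is an open problem; the Yang–Mills mass gap is NOT proved;
no summit is proved by a line.
-/

set_option autoImplicit false

noncomputable section

open scoped SchwartzMap BigOperators ComplexConjugate ContDiff InnerProductSpace
open MeasureTheory Filter Topology Set Metric
open Literature.MathematicalPhysics.QuantumFieldTheory Literature.MathematicalPhysics.QuantumLattice
open Literature.MathematicalPhysics.AQFT
open Summit.QuantumFields.YangMills.Cruxes.OSLegsFromFemtoAndGap.DlrCollarTransfer (RPPos)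
open Summit.QuantumFields.YangMills.Theorems.NPointIsotropy.Negative (E4)
open Summit.QuantumFields.YangMills.Theorems.F4SubCurvatureDoorSubCurvatureKernelPointwiseRP (exists_degOne)
open Summit.QuantumFields.YangMills.Theorems.F4SubCurvatureDoorSubCurvatureKernelMollifier (integral_osShift)

namespace Summit.QuantumFields.YangMills.Theorems.F4SubCurvatureDoorSubCurvatureKernelMollifiedPD

/-! ## §1 Coordinates `(t, z⃗)` -/

/-- `z⃗ ↦ (t, z⃗)` is continuous. [bookkeeping] -/
theorem continuous_ofTimeSpace_right (t : ℝ) :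
    Continuous fun z : EuclideanSpace ℝ (Fin 3) => (ofTimeSpace t z : E4) := by
  have h1 : Continuous fun z : EuclideanSpace ℝ (Fin 3) => (Fin.cons t (WithLp.ofLp z) : Fin 4 → ℝ) := by
    refine continuous_pi fun i => ?_
    refine Fin.cases ?_ (fun j => ?_) i
    · exact continuous_const
    · simp only [Fin.cons_succ]
      exact (PiLp.continuous_apply 2 _ j)
  exact (PiLp.continuous_toLp 2 _).comp h1

/-- `θ(a, z⃗) − (a', z⃗') = (−a − a', z⃗ − z⃗')`. [bookkeeping] -/
theorem timeReflection_ofTimeSpace_sub (a a' : ℝ) (z z' : EuclideanSpace ℝ (Fin 3)) :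
    timeReflection 4 (ofTimeSpace a z : E4) - ofTimeSpace a' z' = ofTimeSpace (-a - a') (z - z') := by
  ext i
  refine Fin.cases ?_ (fun j => ?_) i
  · rw [PiLp.sub_apply, timeReflection_apply, if_pos rfl, ofTimeSpace_apply_zero, ofTimeSpace_apply_zero,
      ofTimeSpace_apply_zero]
  · rw [PiLp.sub_apply, timeReflection_apply, if_neg (Fin.succ_ne_zero j), ofTimeSpace_apply_succ, ofTimeSpace_apply_succ,
      ofTimeSpace_apply_succ, PiLp.sub_apply]

/-- `−θ(a, z⃗) = (a, −z⃗)`. [bookkeeping] -/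
theorem neg_timeReflection_ofTimeSpace (a : ℝ) (z : EuclideanSpace ℝ (Fin 3)) :
    -(timeReflection 4 (ofTimeSpace a z : E4)) = ofTimeSpace a (-z) := by
  ext i
  refine Fin.cases ?_ (fun j => ?_) i
  · rw [PiLp.neg_apply, timeReflection_apply, if_pos rfl, ofTimeSpace_apply_zero, ofTimeSpace_apply_zero, neg_neg]
  · rw [PiLp.neg_apply, timeReflection_apply, if_neg (Fin.succ_ne_zero j), ofTimeSpace_apply_succ, ofTimeSpace_apply_succ,
      PiLp.neg_apply]

/-! ## §2 ★ Pointwise OS-positivity of the mollified kernel from `RPPos` -/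

/-- ★ **The mollified kernel is pointwise OS-positive-definite** on points with time coordinate `≥ s₀`, EXACTLY (no limits):
`RPPos` on the degree-one tuple of translated bumps, clause 6, and the OS change of variables. [cite: OS1973, §2 (E2)]
[cite: GlimmJaffe1987, §6.1] -/
theorem mollified_pd (S₁ : SchwingerFamily E4) (hRP : RPPos S₁) (K : E4 → ℝ)
    (hrep : ∀ F : 𝓢((Fin 2 → E4), ℂ), IsOffDiagonal F → HasCompactSupport (F : (Fin 2 → E4) → ℂ) →
      Integrable (fun x : Fin 2 → E4 => (K (x 0 - x 1) : ℂ) * F x) ∧ S₁ 2 F = ∫ x : Fin 2 → E4, (K (x 0 - x 1) : ℂ) * F x)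
    (b κ : E4 → ℝ) (hbs : ContDiff ℝ ∞ b) {ε s₀ : ℝ} (hε : 0 < ε)
    (hbsupp : ∀ u, b u ≠ 0 → ‖u‖ < ε) (hεs : ε < s₀)
    (hκ : ∀ w : E4, 2 * s₀ ≤ |w 0| → κ w = ∫ p : E4 × E4, K (w + timeReflection 4 p.2 - p.1) * (b p.1 * b p.2))
    (m : ℕ) (x : Fin m → E4) (c : Fin m → ℝ) (hx : ∀ i, s₀ ≤ x i 0) :
    0 ≤ ∑ i, ∑ j, c i * c j * κ (timeReflection 4 (x i) - x j) := by
  classical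
  set θ := timeReflection 4 with hθ
  have hεx : ∀ i, ε < x i 0 := fun i => hεs.trans_le (hx i)
  -- the translated bumps
  set bt : Fin m → E4 → ℝ := fun i u => b (u - x i) with hbt
  have hbt_s : ∀ i, ContDiff ℝ ∞ (bt i) := fun i => hbs.comp (contDiff_id.sub contDiff_const)
  have hbt_supp : ∀ i u, bt i u ≠ 0 → ‖u - x i‖ < ε := fun i u hu => hbsupp _ hu
  have hbt_tsupp : ∀ i, tsupport (bt i) ⊆ closedBall (x i) ε := by
    intro i
    refine closure_minimal (fun u hu => ?_) isClosed_closedBall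
    rw [mem_closedBall, dist_eq_norm]; exact (hbt_supp i u hu).le
  have hbt_c : ∀ i, HasCompactSupport (bt i) := fun i =>
    HasCompactSupport.of_support_subset_isCompact (isCompact_closedBall (x i) ε)
      ((subset_tsupport _).trans (hbt_tsupp i))
  -- the degree-one test functions
  have hf := fun i => exists_degOne (c i) (bt i) (hbt_s i) (hbt_c i)
  choose f hf_apply hf_c hf_supp using hf
  have hf_pos : ∀ i, IsPositiveTimeMulti (f i) := by
    intro i y hy k
    have hy0 : y 0 ∈ closedBall (x i) ε := hbt_tsupp i (hf_supp i hy)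
    rw [Subsingleton.elim k 0]
    have h1 : |(y 0 - x i) 0| ≤ ‖y 0 - x i‖ := by
      simpa [Real.norm_eq_abs] using PiLp.norm_apply_le (p := 2) (y 0 - x i) 0
    rw [mem_closedBall, dist_eq_norm] at hy0
    rw [PiLp.sub_apply] at h1
    have := abs_le.1 (h1.trans hy0)
    linarith [hεx i, this.1]
  have hf_off : ∀ i, IsOffDiagonal (f i) := fun i y hy k => by
    obtain ⟨a, a', haa', -⟩ := (mem_coincidenceLocus y).1 hy
    exact absurd (Subsingleton.elim a a') haa'
  -- the OS products
  set H : Fin m → Fin m → 𝓢((Fin (1 + 1) → E4), ℂ) := fun i j => SchwartzMap.appendTensor (osAdjoint (f i)) (f j) with hH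
  have hH_app : ∀ i j, IsAppendTensorOf (H i j) (osAdjoint (f i)) (f j) := fun i j => isAppendTensorOf_appendTensor _ _
  have hH_val : ∀ i j (y : Fin 2 → E4), H i j y = ((c i * bt i (θ (y 0)) * (c j * bt j (y 1)) : ℝ) : ℂ) := by
    intro i j y
    have h := hH_app i j y
    rw [h, osAdjoint_apply, hf_apply, hf_apply]
    push_cast
    simp only [Complex.conj_ofReal, map_mul]
    congr 1
  have hH_ne : ∀ i j (y : Fin 2 → E4), H i j y ≠ 0 → ‖θ (y 0) - x i‖ < ε ∧ ‖y 1 - x j‖ < ε := by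
    intro i j y hy
    rw [hH_val] at hy
    have h1 : bt i (θ (y 0)) ≠ 0 := by intro h; apply hy; simp [h]
    have h2 : bt j (y 1) ≠ 0 := by intro h; apply hy; simp [h]
    exact ⟨hbt_supp i _ h1, hbt_supp j _ h2⟩
  have hH_c : ∀ i j, HasCompactSupport (H i j : (Fin 2 → E4) → ℂ) := by
    intro i j
    set A : Set E4 := (θ : E4 → E4) ⁻¹' closedBall (x i) ε with hA
    have hAc : IsCompact A := (θ.toHomeomorph.isCompact_preimage).2 (isCompact_closedBall _ _)
    set S : Set (Fin 2 → E4) := (Homeomorph.piFinTwo fun _ : Fin 2 => E4) ⁻¹' (A ×ˢ closedBall (x j) ε) with hS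
    have hSc : IsCompact S := ((Homeomorph.piFinTwo fun _ : Fin 2 => E4).isCompact_preimage).2 (hAc.prod (isCompact_closedBall _ _))
    refine HasCompactSupport.intro hSc fun y hy => ?_
    by_contra hne
    obtain ⟨h1, h2⟩ := hH_ne i j y hne
    apply hy
    show (y 0, y 1) ∈ A ×ˢ closedBall (x j) ε
    refine Set.mk_mem_prod ?_ ?_
    · show θ (y 0) ∈ closedBall (x i) ε
      rw [mem_closedBall, dist_eq_norm]; exact h1.le
    · rw [mem_closedBall, dist_eq_norm]; exact h2.le
  have hH_off : ∀ i j, IsOffDiagonal (show 𝓢((Fin 2 → E4), ℂ) from H i j) := by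
    intro i j
    refine IsOffDiagonal.of_tsupport_subset fun y hy hco => ?_
    obtain ⟨a, a', haa', hya⟩ := (mem_coincidenceLocus y).1 hco
    have h01 : y 0 = y 1 := by
      fin_cases a <;> fin_cases a'
      · exact absurd rfl haa'
      · exact hya
      · exact hya.symm
      · exact absurd rfl haa'
    have hcl : tsupport (H i j : (Fin 2 → E4) → ℂ) ⊆ {y | (y 0) 0 ≤ -(x i 0) + ε ∧ x j 0 - ε ≤ (y 1) 0} := by
      refine closure_minimal (fun z hz => ?_) ?_
      · obtain ⟨h1, h2⟩ := hH_ne i j z hz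
        have e1 : |(θ (z 0) - x i) 0| ≤ ‖θ (z 0) - x i‖ := by
          simpa [Real.norm_eq_abs] using PiLp.norm_apply_le (p := 2) (θ (z 0) - x i) 0
        have e2 : |(z 1 - x j) 0| ≤ ‖z 1 - x j‖ := by
          simpa [Real.norm_eq_abs] using PiLp.norm_apply_le (p := 2) (z 1 - x j) 0
        rw [PiLp.sub_apply, hθ, timeReflection_apply] at e1
        simp only [if_true] at e1
        rw [PiLp.sub_apply] at e2
        constructor
        · have := (abs_le.1 (e1.trans h1.le)).1; linarith
        · have := (abs_le.1 (e2.trans h2.le)).1; linarith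
      · have hc0 : Continuous fun y : Fin 2 → E4 => (y 0) 0 :=
          (EuclideanSpace.proj (0 : Fin 4) : E4 →L[ℝ] ℝ).continuous.comp (continuous_apply 0)
        have hc1 : Continuous fun y : Fin 2 → E4 => (y 1) 0 :=
          (EuclideanSpace.proj (0 : Fin 4) : E4 →L[ℝ] ℝ).continuous.comp (continuous_apply 1)
        exact (isClosed_le hc0 continuous_const).inter (isClosed_le continuous_const hc1)
    have h := hcl hy
    simp only [mem_setOf_eq] at h
    rw [h01] at h
    linarith [h.1, h.2, hεx i, hεx j]
  -- RPPos
  have hz := hRP m (fun _ => 1) f hf_pos hf_off H hH_app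
  -- each term is EXACTLY `cᵢcⱼ κ(θxᵢ − xⱼ)`
  have hterm : ∀ i j, S₁ 2 (H i j) = ((c i * c j * κ (θ (x i) - x j) : ℝ) : ℂ) := by
    intro i j
    obtain ⟨-, hS⟩ := hrep (H i j) (hH_off i j) (hH_c i j)
    rw [hS]
    have h1 : ∫ y : Fin 2 → E4, (K (y 0 - y 1) : ℂ) * H i j y =
        ∫ y : Fin 2 → E4, (((c i * c j) * (K (y 0 - y 1) * (b (θ (y 0) - x i) * b (y 1 - x j))) : ℝ) : ℂ) := by
      refine integral_congr_ae (Eventually.of_forall fun y => ?_)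
      beta_reduce
      rw [hH_val]; push_cast; simp only [hbt]; ring
    rw [h1, integral_complex_ofReal, integral_const_mul]
    -- to `E4 × E4`, then the OS change of variables, then the mollified kernel
    have h2 : ∫ y : Fin 2 → E4, K (y 0 - y 1) * (b (θ (y 0) - x i) * b (y 1 - x j)) =
        ∫ p : E4 × E4, K (p.1 - p.2) * (b (θ p.1 - x i) * b (p.2 - x j)) :=
      (volume_preserving_finTwoArrow E4).integral_comp' (f := MeasurableEquiv.finTwoArrow)
        (fun p : E4 × E4 => K (p.1 - p.2) * (b (θ p.1 - x i) * b (p.2 - x j)))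
    have h3 : 2 * s₀ ≤ |(θ (x i) - x j) 0| := by
      rw [PiLp.sub_apply, hθ, timeReflection_apply, if_pos rfl]
      have : -x i 0 - x j 0 ≤ -(2 * s₀) := by linarith [hx i, hx j]
      rw [abs_of_nonpos (by linarith [hx i, hx j, hεs, hε])]
      linarith
    rw [h2, integral_osShift K b (x i) (x j), ← hκ _ h3]
  -- sum up
  have hsum : (∑ i, ∑ j, S₁ 2 (H i j)) = ((∑ i, ∑ j, c i * c j * κ (θ (x i) - x j) : ℝ) : ℂ) := by
    rw [Complex.ofReal_sum]
    refine Finset.sum_congr rfl fun i _ => ?_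
    rw [Complex.ofReal_sum]
    exact Finset.sum_congr rfl fun j _ => hterm i j
  have hre : 0 ≤ (∑ i, ∑ j, S₁ 2 (H i j)).re := hz.1
  rwa [hsum, Complex.ofReal_re] at hre

/-! ## §3 ★ The Laplace–Fourier measure of the mollified kernel -/

/-- ★ **The mollified kernel has a Laplace–Fourier measure**: `κ(−(2s₀ + t), z⃗) = ∫ e^{−tE} cos⟪q, z⃗⟫ dμ(E, q)` for `t > 0`,
`μ` carried by `E ≥ 0` with `∫ e^{−tE} dμ < ∞`. [cite: GlimmJaffeQP1987, §6.2] [cite: OS1973, §2 (E2)] -/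
theorem exists_laplaceFourier_mollified (S₁ : SchwingerFamily E4) (hRP : RPPos S₁) (K : E4 → ℝ)
    (hrep : ∀ F : 𝓢((Fin 2 → E4), ℂ), IsOffDiagonal F → HasCompactSupport (F : (Fin 2 → E4) → ℂ) →
      Integrable (fun x : Fin 2 → E4 => (K (x 0 - x 1) : ℂ) * F x) ∧ S₁ 2 F = ∫ x : Fin 2 → E4, (K (x 0 - x 1) : ℂ) * F x)
    (b κ : E4 → ℝ) (hbs : ContDiff ℝ ∞ b) {ε s₀ B : ℝ} (hε : 0 < ε)
    (hbsupp : ∀ u, b u ≠ 0 → ‖u‖ < ε) (hεs : ε < s₀)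
    (hκ : ∀ w : E4, 2 * s₀ ≤ |w 0| → κ w = ∫ p : E4 × E4, K (w + timeReflection 4 p.2 - p.1) * (b p.1 * b p.2))
    (hκc : Continuous κ) (hκP : ∀ w, κ (-(timeReflection 4 w)) = κ w) (hκb : ∀ w, |κ w| ≤ B) :
    ∃ μ : Measure (ℝ × EuclideanSpace ℝ (Fin 3)), μ (Iio 0 ×ˢ univ) = 0 ∧ ∀ t : ℝ, 0 < t →
      Integrable (fun p : ℝ × EuclideanSpace ℝ (Fin 3) => Real.exp (-(t * p.1))) μ ∧
      ∀ z : EuclideanSpace ℝ (Fin 3), κ (ofTimeSpace (-(2 * s₀ + t)) z) =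
        ∫ p : ℝ × EuclideanSpace ℝ (Fin 3), Real.exp (-(t * p.1)) * Real.cos ⟪p.2, z⟫_ℝ ∂μ := by
  set θ := timeReflection 4 with hθ
  set k : ℝ → EuclideanSpace ℝ (Fin 3) → ℝ := fun t z => κ (ofTimeSpace (-(2 * s₀ + t)) z) with hk
  have hPD : ∀ (m : ℕ) (t : Fin m → ℝ) (z : Fin m → EuclideanSpace ℝ (Fin 3)) (c : Fin m → ℝ), (∀ i, 0 < t i) →
      0 ≤ ∑ i, ∑ j, c i * c j * k (t i + t j) (z i - z j) := by
    intro m t z c ht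
    have h := mollified_pd S₁ hRP K hrep b κ hbs hε hbsupp hεs hκ m (fun i => ofTimeSpace (s₀ + t i) (z i)) c
      (fun i => by rw [ofTimeSpace_apply_zero]; linarith [ht i])
    refine h.trans_eq (Finset.sum_congr rfl fun i _ => Finset.sum_congr rfl fun j _ => ?_)
    simp only [hk]
    rw [timeReflection_ofTimeSpace_sub]
    congr 3; ring
  have heven : ∀ t z, k t (-z) = k t z := by
    intro t z
    simp only [hk]
    rw [← neg_timeReflection_ofTimeSpace, hκP]
  have hcont : ∀ t, 0 < t → Continuous (k t) := fun t _ => hκc.comp (continuous_ofTimeSpace_right _)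
  have hbdd : ∀ t₀ : ℝ, 0 < t₀ → ∃ M : ℝ, ∀ t : ℝ, t₀ ≤ t → k t 0 ≤ M :=
    fun t₀ _ => ⟨B, fun t _ => (le_abs_self _).trans (hκb _)⟩
  obtain ⟨μ, hμ0, hμ⟩ := Literature.Analysis.FunctionSpaces.exists_laplaceFourierMeasure hPD heven hcont hbdd
  exact ⟨μ, hμ0, fun t ht => ⟨(hμ t ht).1, fun z => (hμ t ht).2 z⟩⟩

end Summit.QuantumFields.YangMills.Theorems.F4SubCurvatureDoorSubCurvatureKernelMollifiedPD

end
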